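import Literature.MathematicalPhysics.QuantumLattice.HubbardNNNHoppingWindowCertificateD4
import HarnessLib

/-!
# Torus-family ⇒ thermodynamic-limit transport for window-type certificates of the `t–t'` Hubbard model

HONEST FRAMING: first certified bounds; not a superconductivity verdict. This file proves NO number. It isolates the
"30-line limit pattern" at the end of `energyDensityTT'_ge_of_window_certificate_d4`
(`HubbardNNNHoppingWindowCertificateD4`, Han 2020 / Ruelle 1969 reading) as ONE reusable lemma:

* `energyDensityTT'_ge_of_torus_family_bound` — if a real `c` and a chemical-potential multiplier `μ` satisfy, for
  every torus side `L ≥ 3` on which a fixed finite set `S ⊆ ℤ²` projects injectively (`x ↦ x mod L`), and for the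
  half particle number `nh ≤ |FermionTorus 2 L|` with `rectN n L = 2 nh`, the finite-torus inequality
  `c + μ ((2 nh)/L² − n) ≤ groundEnergy (hubbardTorusTT' L t t' U) (2 nh) / L²`, then `c ≤ energyDensityTT' t t' U n`
  (`0 ≤ U`, `0 ≤ n < 2`).

The hypothesis is literally what a finite-torus window-certificate theorem delivers once the certificate data are
fixed (`groundEnergy_hubbardTorusTT'_div_ge_of_window_certificate_d4` with `μ_↑ = μ_↓`, or an SU(2)-Ward × `D₄`
variant read in the full `2n`-particle sector); the conclusion is the thermodynamic-limit soundness statement. Written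
for the Ventures crux lines on item stmt-Ventures-21721 (`wardk` stub W3 `stub_wardTL_of_torus` closes from it by a
six-line term; hub-lb team lb-sym, seat hub-lb-sym-eng-3). Deliberately NOT here: any certificate format.

No summit statement is proved here; a certified bound is a number with a certificate; nothing here predicts
superconductivity.
-/

noncomputable section

open Matrix Finset Filter
open scoped ComplexOrder BigOperators

namespace Literature.MathematicalPhysics.QuantumLattice

open HubbardWave0
open Literature.Probability.LatticeModels

/-- **Torus family ⇒ thermodynamic limit.** Let `0 ≤ U`, `0 ≤ n < 2`, `S ⊆ ℤ²` finite, `c μ : ℝ`. If for every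
`L ≥ 3` with `NeZero L` and `x ↦ x mod L` injective on `S`, and every `nh ≤ |FermionTorus 2 L|` with
`ThermodynamicLimit.rectN n L = 2 nh`,
`c + μ ((2 nh : ℝ)/L² − n) ≤ groundEnergy (hubbardTorusTT' L t t' U) (2 nh) / L²`,
then `c ≤ ThermodynamicLimit.energyDensityTT' t t' U n`. This is the limit step of
`energyDensityTT'_ge_of_window_certificate_d4` (injectivity radius `exists_forall_le_injOn_proj`, then
`ThermodynamicLimit.energyDensityTT'_ge_of_eventually_ge_torus` along `L → ∞` with `nh = ⌊n L²/2⌋₊`), made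
certificate-format-free. Ruelle 1969 §3.3–3.4 (existence of the limit and transport of eventual torus bounds), as used by
Han 2020 §3 for translation-invariant bootstrap bounds. [cite: Ruelle1969, §3.3] -/
theorem energyDensityTT'_ge_of_torus_family_bound (t t' : ℝ) {U : ℝ} (hU : 0 ≤ U) {n : ℝ}
    (hn0 : 0 ≤ n) (hn2 : n < 2) (S : Finset (Site 2)) {c μ : ℝ}
    (h : ∀ (L : ℕ) [NeZero L], 3 ≤ L → Set.InjOn (Torus.proj (d := 2) L) ↑S →
      ∀ nh : ℕ, nh ≤ Fintype.card (FermionTorus 2 L) → ThermodynamicLimit.rectN n L = 2 * nh →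
        c + μ * ((((2 * nh : ℕ) : ℝ)) / (L : ℝ) ^ 2 - n) ≤
          groundEnergy (hubbardTorusTT' L t t' U) (2 * nh) / (L : ℝ) ^ 2) :
    c ≤ ThermodynamicLimit.energyDensityTT' t t' U n := by
  obtain ⟨L₀, hL₀⟩ := exists_forall_le_injOn_proj S
  refine ThermodynamicLimit.energyDensityTT'_ge_of_eventually_ge_torus t t' hU hn0 hn2 (μ := μ) ?_
  filter_upwards [Filter.eventually_ge_atTop (max L₀ 3)] with L hL
  have hL3 : 3 ≤ L := le_trans (le_max_right _ _) hL
  have hLL : L₀ ≤ L := le_trans (le_max_left _ _) hL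
  haveI : NeZero L := ⟨by omega⟩
  set nh : ℕ := ⌊n * (L : ℝ) ^ 2 / 2⌋₊ with hnh
  have hrect : ThermodynamicLimit.rectN n L = 2 * nh := rfl
  have hn : nh ≤ Fintype.card (FermionTorus 2 L) := by
    have h2 := ThermodynamicLimit.rectN_le_two_mul hn0 hn2.le L
    rw [hrect] at h2
    have hcard : Fintype.card (FermionTorus 2 L) = L ^ 2 := by simp [FermionTorus]
    rw [hcard, sq]
    omega
  have hmain := h L hL3 (hL₀ L hLL) nh hn hrect
  rw [hrect]
  exact hmain

end Literature.MathematicalPhysics.QuantumLattice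

end
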